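import Summits.BirchSwinnertonDyer.BirchSwinnertonDyer.Theorems.KolyvaginDepthDoorDepthTableKuriharaSplit
import Summits.BirchSwinnertonDyer.BirchSwinnertonDyer.Theorems.KolyvaginDepthDoorDepthTableKuriharaESide6
import Summits.BirchSwinnertonDyer.BirchSwinnertonDyer.Theorems.KolyvaginDepthDoorDepthTableRankTwo664a1TwistBSDQuotient
import Literature.NumberTheory.EllipticCurves.BSDSelmerPConverseSerreProofs
import HarnessLib

/-!
# Route `KolyvaginDepthDoor`, crux `KolyvaginDepthSupplyKN` (stmt-BirchSwinnertonDyer-22820) —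
# DEPTH TABLE v19, ROW `664a1` @ `(11, d_K = −39)` (SPLIT CELL): the E-side at `p = 11` from the tree record `cert_664a1` @
# `(11, 463·1013)` and the SOCKET for the fleet's twist record (twist model `T₀ = [0, 0, 0, -10647, -593190]` = `664a1^{(−39)}`,
# conductor `1009944`)

Helper file of the lead prover of line `levelone` (kdd-p1 g23; `--supports stmt-BirchSwinnertonDyer-22820
--as helper`); it closes nothing and BSD is NOT proved by it.

CORRECTION OF THE ROW'S PRIME (v17/v18 listed `664a1` at `(7, −39)`): `664a1` (`N = 664 = 2³·83`, ONE multiplicative prime) is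
off W. Zhang's ♠ cell, so its row runs on the SPLIT (Castella–Sano) cell, which needs `p` SPLIT in `K`; but `7` is INERT in
`ℚ(√−39)` (`−39 ≡ 3 (mod 7)`, a non-residue). Of the primes where the lineage's E-side record exists (`7, 11, 13`), `13 ∣ 39` is
excluded and `11` SPLITS (`−39 ≡ 5 ≡ 4² (mod 11)`). So the row is `(11, −39)`, and this file first builds the E-SIDE AT `11`
(as g22 did for `718b1` at `13`): `#Ẽ(𝔽₁₁) = 15` (`a_11 = −3`: good ordinary, non-anomalous), `ρ̄_{E,11}` onto by Serre's
Prop. 19 (additive at `2`, so Prop. 21 is unavailable; witnesses `q = 37` (`a = −3`, `a² − 4q ≡ 4 = 2²`), `q = 3` (`a = −3`,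
`a² − 4q ≡ 8` non-square), `q = 3` (`u = a²/q ≡ 3`)), the record `cert_664a1` @ `(11, 469019 = 463·1013, ν = 2, δ̃ ≡ 7)`
(`KuriharaCertificates/RecordsN000651to000685`) with `#Ẽ(𝔽₄₆₃) = 495 = 11·45`, `#Ẽ(𝔽₁₀₁₃) = 1056 = 11·96` (`121 ∤`), hence
`C664a1.sha_inf_torsionBy_eq_bot_of_kuriharaClaim_11`: `Ш(664a1/ℚ)[11] = 0` modulo Kim Thm. 1.11, modularity, Mazur Cor. 4.1 BY
NAME and the record's claim. Then the twist model at `11` (`#T̃₀(𝔽₁₁) = 15`, non-anomalous; Kodaira–Néron at `11` from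
`Δ(T₀) = −2⁸·3⁶·13⁶·83`) and

* `cruxBody_of_twistKuriharaClaim_11_neg39` — **THE SOCKET**: for every `K` with `d_K = −39`, IF some cyclic Kolyvagin level `m` of
  `(T₀, 11)` with `ν(m) ≤ 2` carries a unit mod-`11` Kurihara number (the CLAIM of a future tree record `cert_<T₀>` at `(11, m)`,
  hypothesis `hδT`), THEN the clause of `KolyvaginDepthSupplyKN` holds at `W = 664a1` verbatim — v17's `cruxBody_of_kuriharaClaims_split`
  with every other input discharged (Kim Thm. 1.11, modularity, Mazur Cor. 4.1, Castella–Sano Thm. 3, Zanarella 2.18, Howard–Zanarella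
  BY NAME). Candidate cyclic Kolyvagin primes of `(T₀, 11)`: the fleet enumerates `ℓ ∤ 11·1009944`, `ℓ ≡ 1 (mod 11)`, `a_ℓ(T₀) ≡ 2
  (mod 11)`, `121 ∤ #T̃₀(𝔽_ℓ)` (the v18 §2b list for this curve was computed at `p = 7` and is void).

CONDITIONAL on the named facts displayed and on the record claims; per curve; nothing class-wide; BSD is NOT proved by any of this.

References: [Kim2022StructureSelmer] Thm. 1.11, §1.2.2; [CastellaSano2026] Thm. 3; [Zanarella2019] Prop. 2.18; [Howard2004]
Lemma 1.6.4; [Mazur1978] Cor. 4.1; [Serre1972] §2.8 Prop. 19; [CremonaAlgorithms1997] Table 1 (664a1); [SilvermanAEC2009] VII.3.1,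
VII.5.1, X.5 Cor. 5.4; [Cox2013] Prop. 5.16.
-/

set_option linter.dupNamespace false

noncomputable section

open scoped Classical NumberField

namespace Summit.BirchSwinnertonDyer.BirchSwinnertonDyer.Theorems.KolyvaginDepthDoor

open Literature.NumberTheory.EllipticCurves Literature.NumberTheory.EllipticCurves.ModularForms
  WeierstrassCurve NumberField IsDedekindDomain
open Summit.BirchSwinnertonDyer.BirchSwinnertonDyer.Theorems
open Summit.BirchSwinnertonDyer.BirchSwinnertonDyer.Rank2Observatory
open Summit.BirchSwinnertonDyer.BirchSwinnertonDyer.Rank1Residual (IntModel.frobeniusTrace_eq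
  IntModel.hasSurjectiveModNGaloisRep_of_intModel_of_serreWitnesses)
open Summit.BirchSwinnertonDyer.Rank1Residual.Supersingular (natCard_point_eq_of_countPoints countPoints_eq_of_fast)
open Summit.BirchSwinnertonDyer.Rank1Residual.Additive (card_torsion_le_of_intModel_of_card
  isKolyvaginPrime_of_intModel_of_card isKolyvaginProduct_mul)

/-- An ODD prime `p` splits in a quadratic field of discriminant `D` when the Jacobi symbol `(D/p) = 1` (decomposition law
in quadratic fields, via `satisfiesHeegnerHypothesis_iff_kronecker` at the prime level `p`; file-local twin of the lemma of
`…KuriharaSocket916c1`). [cite: Cox2013, Prop. 5.16 and Cor. 5.17] -/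
private theorem satisfiesHeegnerHypothesis_prime_of_jacobiSym664 (K : Type) [Field K] [NumberField K]
    (h2 : Module.finrank ℚ K = 2) {D : ℤ} (hD : NumberField.discr K = D) (p : ℕ) (hp : p.Prime) (hp2 : p ≠ 2)
    (hj : jacobiSym D p = 1) : SatisfiesHeegnerHypothesis p K := by
  rw [satisfiesHeegnerHypothesis_iff_kronecker p K h2, hD]
  intro q hq hqp
  obtain rfl : q = p := (Nat.prime_dvd_prime_iff_eq hq hp).mp hqp
  exact ⟨fun h ↦ absurd h hp2, fun _ ↦ hj⟩

/-! ## `664a1` = `[0, 0, 0, -7, 10]` at `p = 11`: record `cert_664a1` @ `(11, 463·1013)`, `δ̃ ≡ 7` -/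

namespace C664a1

/-- `#Ẽ(𝔽_11) = 15` for `664a1` (`a_11 = -3`: good ordinary, non-anomalous at `11`), kernel-decided (`countPointsFast`). [cite: CremonaAlgorithms1997, Table 1 (664a1)] -/
theorem card_11 :
    Nat.card (((⟨0, 0, 0, -7, 10⟩ : WeierstrassCurve ℤ).map (Int.castRingHom (ZMod 11))).toAffine.Point) = 15 :=
  haveI : Fact (Nat.Prime 11) := ⟨by norm_num⟩
  natCard_point_eq_of_countPoints 0 0 0 (-7) 10 11 (by norm_num) (by decide +kernel) (n := 15)
    (countPoints_eq_of_fast (by decide +kernel))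

/-- `#Ẽ(𝔽_37) = 41` for `664a1` (`a_37 = -3`; Serre Prop. 19 witness i) at `p = 11`), kernel-decided (`countPointsFast`). [cite: CremonaAlgorithms1997, Table 1 (664a1)] -/
theorem card_37 :
    Nat.card (((⟨0, 0, 0, -7, 10⟩ : WeierstrassCurve ℤ).map (Int.castRingHom (ZMod 37))).toAffine.Point) = 41 :=
  haveI : Fact (Nat.Prime 37) := ⟨by norm_num⟩
  natCard_point_eq_of_countPoints 0 0 0 (-7) 10 37 (by norm_num) (by decide +kernel) (n := 41)
    (countPoints_eq_of_fast (by decide +kernel))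

/-- `#Ẽ(𝔽_463) = 495` for `664a1` (`463 ≡ 1`, `a_463 = -31 ≡ 2 (mod 11)`, `11² ∤ 495`), kernel-decided (`countPointsFast`). [cite: CremonaAlgorithms1997, Table 1 (664a1)] -/
theorem card_463 :
    Nat.card (((⟨0, 0, 0, -7, 10⟩ : WeierstrassCurve ℤ).map (Int.castRingHom (ZMod 463))).toAffine.Point) = 495 :=
  haveI : Fact (Nat.Prime 463) := ⟨by norm_num⟩
  natCard_point_eq_of_countPoints 0 0 0 (-7) 10 463 (by norm_num) (by decide +kernel) (n := 495)
    (countPoints_eq_of_fast (by decide +kernel))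

/-- `#Ẽ(𝔽_1013) = 1056` for `664a1` (`1013 ≡ 1`, `a_1013 = -42 ≡ 2 (mod 11)`, `11² ∤ 1056`), kernel-decided (`countPointsFast`). [cite: CremonaAlgorithms1997, Table 1 (664a1)] -/
theorem card_1013 :
    Nat.card (((⟨0, 0, 0, -7, 10⟩ : WeierstrassCurve ℤ).map (Int.castRingHom (ZMod 1013))).toAffine.Point) = 1056 :=
  haveI : Fact (Nat.Prime 1013) := ⟨by norm_num⟩
  natCard_point_eq_of_countPoints 0 0 0 (-7) 10 1013 (by norm_num) (by decide +kernel) (n := 1056)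
    (countPoints_eq_of_fast (by decide +kernel))

/-- **`11` is good ordinary for `664a1`** (`11 ∤ Δ`, `a_11 = -3`). [cite: CremonaAlgorithms1997, Table 1 (664a1)] -/
theorem goodOrdinary_11 :
    haveI := Fact.mk (by norm_num : Nat.Prime 11); haveI := isGloballyMinimal_c664a1;
    ((⟨0, 0, 0, -7, 10⟩ : WeierstrassCurve ℤ).map (Int.castRingHom ℚ)).HasGoodReductionAtPrime 11 ∧ ¬ ((11 : ℕ) : ℤ) ∣ ((⟨0, 0, 0, -7, 10⟩ : WeierstrassCurve ℤ).map (Int.castRingHom ℚ)).frobeniusTrace 11 := by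
  haveI := Fact.mk (by norm_num : Nat.Prime 11)
  haveI := isElliptic_c664a1
  haveI := isGloballyMinimal_c664a1
  exact goodOrdinary_of_intModel_certificate intModel 11 (by decide +kernel) (n := 15) card_11 (by decide +kernel)

/-- **`ρ̄_{E,11}` is surjective for `664a1`** (additive at `2`, so Serre's Prop. 21 is unavailable — Serre's Prop. 19 instead,
tree theorem `IntModel.hasSurjectiveModNGaloisRep_of_intModel_of_serreWitnesses`): Frobenius witnesses i) `q = 37`, `a = −3`:
`a² − 4q ≡ 4 = 2²` a non-zero square mod `11`, `a ≢ 0`; ii) `q = 3`, `a = −3`: `a² − 4q ≡ 8` a non-square mod `11`, `a ≢ 0`;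
iii) `q = 3`: `u = a²/q ≡ 3`, `u ∉ {0,1,2,4}`, `u² − 3u + 1 ≡ 1 ≢ 0` — all kernel-decided on `card_37` and the lineage's `card_3`.
[cite: Serre1972, §2.8 Prop. 19 and §5.2 (iii)] -/
theorem hasSurjectiveModNGaloisRep_11 :
    haveI := isElliptic_c664a1;
    ((⟨0, 0, 0, -7, 10⟩ : WeierstrassCurve ℤ).map (Int.castRingHom ℚ)).HasSurjectiveModNGaloisRep (11 : ℕ) := by
  have hi : IsSquare (((((37 : ℕ) : ℤ) + 1 - (41 : ℕ) : ℤ) : ZMod 11) ^ 2 - 4 * ((37 : ℕ) : ZMod 11)) ∧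
      ((((37 : ℕ) : ℤ) + 1 - (41 : ℕ) : ℤ) : ZMod 11) ^ 2 - 4 * ((37 : ℕ) : ZMod 11) ≠ 0 ∧
        ((((37 : ℕ) : ℤ) + 1 - (41 : ℕ) : ℤ) : ZMod 11) ≠ 0 := by
    decide +kernel
  have hii : ¬ IsSquare (((((3 : ℕ) : ℤ) + 1 - (7 : ℕ) : ℤ) : ZMod 11) ^ 2 - 4 * ((3 : ℕ) : ZMod 11)) ∧
      ((((3 : ℕ) : ℤ) + 1 - (7 : ℕ) : ℤ) : ZMod 11) ≠ 0 := by
    decide +kernel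
  have hiii : ∃ u : ZMod 11, ((((3 : ℕ) : ℤ) + 1 - (7 : ℕ) : ℤ) : ZMod 11) ^ 2 = u * ((3 : ℕ) : ZMod 11) ∧
      u ≠ 0 ∧ u ≠ 1 ∧ u ≠ 2 ∧ u ≠ 4 ∧ u ^ 2 - 3 * u + 1 ≠ 0 := ⟨3, by decide +kernel⟩
  haveI := Fact.mk (by norm_num : Nat.Prime 3)
  haveI := Fact.mk (by norm_num : Nat.Prime 11)
  haveI := Fact.mk (by norm_num : Nat.Prime 37)
  haveI := isElliptic_c664a1
  haveI := isGloballyMinimal_c664a1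
  exact IntModel.hasSurjectiveModNGaloisRep_of_intModel_of_serreWitnesses intModel 11 (by norm_num) 37 3 3
    (by norm_num) (by norm_num) (by norm_num) (by decide +kernel) (by decide +kernel) (by decide +kernel)
    (n₁ := 41) (n₂ := 7) (n₃ := 7) card_37 card_3 card_3 hi hii hiii

/-- **`11` is non-anomalous for `664a1`**: `a_11 − 1 = -4`. [cite: SilvermanAEC2009, VII.3 Prop. 3.1] -/
theorem nonAnomalous_11 :
    haveI := isGloballyMinimal_c664a1; haveI := Fact.mk (by norm_num : Nat.Prime 11);
    ¬ ((11 : ℕ) : ℤ) ∣ ((⟨0, 0, 0, -7, 10⟩ : WeierstrassCurve ℤ).map (Int.castRingHom ℚ)).frobeniusTrace 11 - 1 := by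
  haveI := isElliptic_c664a1; haveI := isGloballyMinimal_c664a1; haveI := Fact.mk (by norm_num : Nat.Prime 11)
  rw [IntModel.frobeniusTrace_eq intModel card_11]
  decide

/-- **`469019 = 463·1013` is a cyclic Kolyvagin level for `(664a1, 11)`** — the level of the tree record `cert_664a1` at `p = 11`.
[cite: Kim2022StructureSelmer, §1.2.2 (PDF p. 5)] -/
theorem isCyclicKolyvaginLevel_11_469019 :
    haveI := isGloballyMinimal_c664a1; haveI := Fact.mk (by norm_num : Nat.Prime 11);
    IsCyclicKolyvaginLevel ((⟨0, 0, 0, -7, 10⟩ : WeierstrassCurve ℤ).map (Int.castRingHom ℚ)) 11 469019 := by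
  haveI := isElliptic_c664a1
  haveI := isGloballyMinimal_c664a1
  haveI := Fact.mk (by norm_num : Nat.Prime 11)
  haveI : Fact (Nat.Prime 463) := ⟨by norm_num⟩
  haveI : Fact (Nat.Prime 1013) := ⟨by norm_num⟩
  have h₁ : Kato.IsKolyvaginPrime ((⟨0, 0, 0, -7, 10⟩ : WeierstrassCurve ℤ).map (Int.castRingHom ℚ)) 11 1 463 :=
    isKolyvaginPrime_of_intModel_of_card intModel 11 1 463 (by norm_num) (by decide +kernel) (by decide) card_463
      (by norm_num)
  have h₂ : Kato.IsKolyvaginPrime ((⟨0, 0, 0, -7, 10⟩ : WeierstrassCurve ℤ).map (Int.castRingHom ℚ)) 11 1 1013 :=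
    isKolyvaginPrime_of_intModel_of_card intModel 11 1 1013 (by norm_num) (by decide +kernel) (by decide) card_1013
      (by norm_num)
  refine ⟨by simpa using isKolyvaginProduct_mul h₁ h₂ (by norm_num), fun ℓ hℓ hdvd ↦ ?_⟩
  rw [show (469019 : ℕ) = 463 * 1013 from rfl] at hdvd
  rcases (Nat.Prime.dvd_mul hℓ.out).mp hdvd with h | h
  · obtain rfl := (Nat.prime_dvd_prime_iff_eq hℓ.out (by norm_num)).mp h
    exact card_torsion_le_of_intModel_of_card intModel 11 463 card_463 (by norm_num)
  · obtain rfl := (Nat.prime_dvd_prime_iff_eq hℓ.out (by norm_num)).mp h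
    exact card_torsion_le_of_intModel_of_card intModel 11 1013 card_1013 (by norm_num)

/-- **`Ш(664a1/ℚ)[11] = 0` FROM THE TREE RECORD `cert_664a1` @ `(11, 463·1013)`** (Kurihara currency): granted Kim 2026 Thm. 1.11
(`hKim`), modularity (`hnf`), Mazur 1978 Cor. 4.1 (`hMaz`) BY NAME and the record's CLAIM `hδ` (read at level `N_E` through
`KuriharaCertificates.Record.Claim`), `#Sel_11(E/ℚ) ≤ 11² = 11^rank` and so `Ш(E/ℚ)[11] = 0` (`11` good ordinary `goodOrdinary_11`,
`ρ̄_{E,11}` onto `hasSurjectiveModNGaloisRep_11` (Serre Prop. 19 witnesses), `nonAnomalous_11`, Kodaira–Néron `kodairaNeron_of_five_le 11`,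
`2 ≤ rank` `KernelCerts001.C664a1.two_le_rank`). CONDITIONAL on the three named facts and the claim; per curve; BSD is not proved by it.
[cite: Kim2022StructureSelmer, Thm. 1.11 (PDF p. 8)] [cite: Mazur1978, Cor. 4.1] [cite: CremonaAlgorithms1997, Table 1 (664a1)] -/
theorem sha_inf_torsionBy_eq_bot_of_kuriharaClaim_11
    (hKim : Kim2022_card_selmerGroup_le_pow_of_kuriharaNumber_ne_zero)
    (hnf : exists_isNewformOf) (hMaz : mazur_not_dvd_maninConstant_of_odd)
    (hδ : haveI := isElliptic_c664a1; haveI := isGloballyMinimal_c664a1;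
      haveI : NeZero (((⟨0, 0, 0, -7, 10⟩ : WeierstrassCurve ℤ).map (Int.castRingHom ℚ)).conductorNorm ℤ) := neZero_conductorNorm_of_isElliptic _;
      haveI := Fact.mk (by norm_num : Nat.Prime 11);
      ∀ (D : ModularParametrizationData ((⟨0, 0, 0, -7, 10⟩ : WeierstrassCurve ℤ).map (Int.castRingHom ℚ)) (((⟨0, 0, 0, -7, 10⟩ : WeierstrassCurve ℤ).map (Int.castRingHom ℚ)).conductorNorm ℤ)), ¬ ((11 : ℕ) : ℤ) ∣ D.maninConstant →
        (∃ u : ℚ, ‖(u : ℚ_[11])‖ = 1 ∧ ((⟨0, 0, 0, -7, 10⟩ : WeierstrassCurve ℤ).map (Int.castRingHom ℚ)).realPeriodRat = u * plusPeriod D.f) →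
        ∃ ψ : (ℓ : ℕ) → (ZMod ℓ)ˣ →* Multiplicative (ZMod 11),
          (∀ ℓ ∈ (469019 : ℕ).primeFactors, Function.Surjective (ψ ℓ)) ∧ kuriharaNumber D.f 11 469019 ψ ≠ 0) :
    haveI := isElliptic_c664a1; haveI := isGloballyMinimal_c664a1; haveI := Fact.mk (by norm_num : Nat.Prime 11);
    (((⟨0, 0, 0, -7, 10⟩ : WeierstrassCurve ℤ).map (Int.castRingHom ℚ)).sha ⊓ AddSubgroup.torsionBy ((⟨0, 0, 0, -7, 10⟩ : WeierstrassCurve ℤ).map (Int.castRingHom ℚ)).galH1 ((11 : ℕ) : ℤ) : AddSubgroup _) = ⊥ := by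
  haveI := isElliptic_c664a1
  haveI := isGloballyMinimal_c664a1
  haveI iNZ : NeZero (((⟨0, 0, 0, -7, 10⟩ : WeierstrassCurve ℤ).map (Int.castRingHom ℚ)).conductorNorm ℤ) := neZero_conductorNorm_of_isElliptic _
  haveI := Fact.mk (by norm_num : Nat.Prime 11)
  haveI : NeZero (469019 : ℕ) := ⟨by norm_num⟩
  have hν : (469019 : ℕ).primeFactors.card ≤ ((⟨0, 0, 0, -7, 10⟩ : WeierstrassCurve ℤ).map (Int.castRingHom ℚ)).mordellWeilRank := by
    refine le_trans (le_of_eq ?_) KernelCerts001.C664a1.two_le_rank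
    rw [show (469019 : ℕ) = 463 * 1013 from rfl, Nat.primeFactors_mul (by norm_num) (by norm_num),
      Nat.Prime.primeFactors (by norm_num), Nat.Prime.primeFactors (by norm_num)]
    decide
  exact sha_inf_torsionBy_eq_bot_of_kuriharaClaim hKim hnf hMaz _ 11 (by norm_num) goodOrdinary_11.1 goodOrdinary_11.2
    hasSurjectiveModNGaloisRep_11 nonAnomalous_11 (kodairaNeron_of_five_le 11 (by norm_num)) 469019 isCyclicKolyvaginLevel_11_469019 hν hδ

/-! ## The twist model `T₀ = [0, 0, 0, -10647, -593190]` at `11` -/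

/-- `#T̃₀(𝔽_11) = 15` for the twist model `T₀ = [0, 0, 0, -10647, -593190]` (`a_11(T₀) = −3 = a_11(E)`, as `11` splits in
`ℚ(√−39)`), kernel-decided (`countPointsFast`). [cite: SilvermanAEC2009, V.2] -/
theorem minTwist39_card_11 :
    Nat.card (((⟨0, 0, 0, -10647, -593190⟩ : WeierstrassCurve ℤ).map (Int.castRingHom (ZMod 11))).toAffine.Point) = 15 :=
  haveI : Fact (Nat.Prime 11) := ⟨by norm_num⟩
  natCard_point_eq_of_countPoints 0 0 0 (-10647) (-593190) 11 (by norm_num) (by decide +kernel) (n := 15)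
    (countPoints_eq_of_fast (by decide +kernel))

/-- **`11` is non-anomalous for the twist model `T₀ = [0, 0, 0, -10647, -593190]`**: `a_11(T₀) = −3`, `11 ∤ a_11(T₀) − 1`
(Sakamoto's hypothesis (c) / Kim's (iii) for `T₀`). [cite: SilvermanAEC2009, VII.3 Prop. 3.1] -/
theorem minTwist39_nonAnomalous_11 :
    haveI := minTwist39_isGloballyMinimal; haveI := Fact.mk (by norm_num : Nat.Prime 11);
    ¬ ((11 : ℕ) : ℤ) ∣ ((⟨0, 0, 0, -10647, -593190⟩ : WeierstrassCurve ℤ).map (Int.castRingHom ℚ)).frobeniusTrace 11 - 1 := by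
  haveI := minTwist39_isElliptic
  haveI := minTwist39_isGloballyMinimal
  haveI := Fact.mk (by norm_num : Nat.Prime 11)
  rw [IntModel.frobeniusTrace_eq minTwist39_intModel minTwist39_card_11]
  decide

/-- **Kodaira–Néron for `T₀ = [0, 0, 0, -10647, -593190]` at `11`**: `11 ∤ ord_v(Δ_{T₀})` at every multiplicative place
(`Δ(T₀) = −74766267433728 = −2⁸·3⁶·13⁶·83 < 596^11` in absolute value; exponents `8, 6, 6, 1`, none divisible by `11`; table lemma
`not_dvd_ordMinimalDiscriminant_of_intModel_table`, as `minTwist39_kodairaNeron_5`). [cite: SilvermanAEC2009, VII.5.1, VIII.8] -/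
theorem minTwist39_kodairaNeron_11 :
    haveI := minTwist39_isElliptic; haveI := minTwist39_isGloballyMinimal;
    ∀ v : HeightOneSpectrum (𝓞 ℚ),
      ((⟨0, 0, 0, -10647, -593190⟩ : WeierstrassCurve ℤ).map (Int.castRingHom ℚ)).HasMultiplicativeReductionAt v →
      ¬ 11 ∣ ((⟨0, 0, 0, -10647, -593190⟩ : WeierstrassCurve ℤ).map (Int.castRingHom ℚ)).ordMinimalDiscriminant v := by
  haveI := minTwist39_isElliptic
  haveI := minTwist39_isGloballyMinimal
  exact not_dvd_ordMinimalDiscriminant_of_intModel_table minTwist39_intModel (p := 11) (Δ₀ := (-74766267433728))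
    (by decide +kernel) (B := 596) (by decide +kernel)
    (by
      intro q hq hqP hqd
      have hn : ((-74766267433728 : ℤ).natAbs) = 2 ^ 8 * (3 ^ 6 * (13 ^ 6 * (83 ^ 1))) := by norm_num
      rw [hn] at hqd ⊢
      rcases (Nat.Prime.dvd_mul hqP).mp hqd with h | h0
      · obtain rfl := (Nat.prime_dvd_prime_iff_eq hqP (by norm_num)).mp (hqP.dvd_of_dvd_pow h)
        exact ⟨8, by simp, by decide +kernel, by decide +kernel, by norm_num⟩
      · rcases (Nat.Prime.dvd_mul hqP).mp h0 with h | h1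
        · obtain rfl := (Nat.prime_dvd_prime_iff_eq hqP (by norm_num)).mp (hqP.dvd_of_dvd_pow h)
          exact ⟨6, by simp, by decide +kernel, by decide +kernel, by norm_num⟩
        · rcases (Nat.Prime.dvd_mul hqP).mp h1 with h | h2
          · obtain rfl := (Nat.prime_dvd_prime_iff_eq hqP (by norm_num)).mp (hqP.dvd_of_dvd_pow h)
            exact ⟨6, by simp, by decide +kernel, by decide +kernel, by norm_num⟩
          · obtain rfl := (Nat.prime_dvd_prime_iff_eq hqP (by norm_num)).mp (hqP.dvd_of_dvd_pow h2)
            exact ⟨1, by simp, by decide +kernel, by decide +kernel, by norm_num⟩)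

/-! ## The socket (split cell, `p = 11` split in `ℚ(√−39)`) -/

/-- **THE SOCKET for row `664a1` @ `(11, −39)` (split cell): the clause of `KolyvaginDepthSupplyKN` at `W = 664a1` from the
E-side record claim at `11` and ONE FUTURE twist record claim.** For every imaginary quadratic `K` with `d_K = −39`: granted
Kim Thm. 1.11 (`hKim`), modularity (`hnf`), Mazur Cor. 4.1 (`hMaz`), Castella–Sano Thm. 3 (`h3`), Zanarella 2.18 (`hZ`),
Howard–Zanarella (`hHZ`) BY NAME, the claim `hδE` of the tree record `cert_664a1` @ `(11, 469019 = 463·1013)`, and — THE DATUM OWED —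
a cyclic Kolyvagin level `m` of `(T₀, 11)` (`hm`) of depth `ν(m) ≤ 2` (`hμ`) whose claim `hδT` holds, the crux's clause holds at
`664a1` VERBATIM (`11` split in `K`: `(−39/11) = 1`; `d_K` odd). CONDITIONAL on the six named facts and the two claims; per
curve; BSD is not proved by it. [cite: Kim2022StructureSelmer, Thm. 1.11 (PDF p. 8)] [cite: CastellaSano2026, Thm. 3 (arXiv:2601.14504 §1.1.6)]
[cite: Zanarella2019, Prop. 2.18] [cite: Howard2004, Lemma 1.6.4] [cite: Mazur1978, Cor. 4.1] [cite: CremonaAlgorithms1997, Table 1 (664a1)] -/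
theorem cruxBody_of_twistKuriharaClaim_11_neg39
    (hKim : Kim2022_card_selmerGroup_le_pow_of_kuriharaNumber_ne_zero)
    (hnf : exists_isNewformOf) (hMaz : mazur_not_dvd_maninConstant_of_odd)
    (h3 : Literature.NumberTheory.EllipticCurves.CastellaSano2026_kolyvaginClass_selmerDivisibility_eq_padicValNat_tamagawaProduct)
    (hZ : Literature.NumberTheory.EllipticCurves.Zanarella2019_kolyvaginClass_one_ne_zero_of_not_selmerDivisible)
    (hHZ : Literature.NumberTheory.EllipticCurves.HowardZanarella_exists_minimal_kolyvaginClass_one_selmerCard_of_ne_zero)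
    (K : Type) [Field K] [NumberField K] (hK : IsImaginaryQuadratic K) (hD : NumberField.discr K = -39)
    (hδE : haveI := isElliptic_c664a1; haveI := isGloballyMinimal_c664a1;
      haveI : NeZero (((⟨0, 0, 0, -7, 10⟩ : WeierstrassCurve ℤ).map (Int.castRingHom ℚ)).conductorNorm ℤ) := neZero_conductorNorm_of_isElliptic _;
      haveI := Fact.mk (by norm_num : Nat.Prime 11);
      ∀ (D : ModularParametrizationData ((⟨0, 0, 0, -7, 10⟩ : WeierstrassCurve ℤ).map (Int.castRingHom ℚ)) (((⟨0, 0, 0, -7, 10⟩ : WeierstrassCurve ℤ).map (Int.castRingHom ℚ)).conductorNorm ℤ)), ¬ ((11 : ℕ) : ℤ) ∣ D.maninConstant →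
        (∃ u : ℚ, ‖(u : ℚ_[11])‖ = 1 ∧ ((⟨0, 0, 0, -7, 10⟩ : WeierstrassCurve ℤ).map (Int.castRingHom ℚ)).realPeriodRat = u * plusPeriod D.f) →
        ∃ ψ : (ℓ : ℕ) → (ZMod ℓ)ˣ →* Multiplicative (ZMod 11),
          (∀ ℓ ∈ (469019 : ℕ).primeFactors, Function.Surjective (ψ ℓ)) ∧ kuriharaNumber D.f 11 469019 ψ ≠ 0)
    (m : ℕ) [NeZero m]
    (hm : haveI := minTwist39_isGloballyMinimal;
      IsCyclicKolyvaginLevel ((⟨0, 0, 0, -10647, -593190⟩ : WeierstrassCurve ℤ).map (Int.castRingHom ℚ)) 11 m)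
    (hμ : m.primeFactors.card ≤ 2)
    (hδT : haveI := minTwist39_isElliptic; haveI := minTwist39_isGloballyMinimal;
      haveI : NeZero (((⟨0, 0, 0, -10647, -593190⟩ : WeierstrassCurve ℤ).map (Int.castRingHom ℚ)).conductorNorm ℤ) :=
        neZero_conductorNorm_of_isElliptic _;
      haveI := Fact.mk (by norm_num : Nat.Prime 11);
      ∀ (D : ModularParametrizationData ((⟨0, 0, 0, -10647, -593190⟩ : WeierstrassCurve ℤ).map (Int.castRingHom ℚ))
          (((⟨0, 0, 0, -10647, -593190⟩ : WeierstrassCurve ℤ).map (Int.castRingHom ℚ)).conductorNorm ℤ)),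
        ¬ ((11 : ℕ) : ℤ) ∣ D.maninConstant →
        (∃ u : ℚ, ‖(u : ℚ_[11])‖ = 1 ∧
          ((⟨0, 0, 0, -10647, -593190⟩ : WeierstrassCurve ℤ).map (Int.castRingHom ℚ)).realPeriodRat = u * plusPeriod D.f) →
        ∃ ψ : (ℓ : ℕ) → (ZMod ℓ)ˣ →* Multiplicative (ZMod 11),
          (∀ ℓ ∈ m.primeFactors, Function.Surjective (ψ ℓ)) ∧ kuriharaNumber D.f 11 m ψ ≠ 0) :
    haveI := isElliptic_c664a1; haveI := isGloballyMinimal_c664a1;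
    ∃ (p : ℕ) (hp : Fact p.Prime), 5 ≤ p ∧ ((⟨0, 0, 0, -7, 10⟩ : WeierstrassCurve ℤ).map (Int.castRingHom ℚ)).HasGoodReductionAtPrime p ∧
      ¬ (p : ℤ) ∣ ((⟨0, 0, 0, -7, 10⟩ : WeierstrassCurve ℤ).map (Int.castRingHom ℚ)).frobeniusTrace p ∧
      (∀ n : ℕ, ((⟨0, 0, 0, -7, 10⟩ : WeierstrassCurve ℤ).map (Int.castRingHom ℚ)).HasSurjectiveModNGaloisRep (p ^ n : ℕ)) ∧
      (∀ v : HeightOneSpectrum (𝓞 ℚ), ((⟨0, 0, 0, -7, 10⟩ : WeierstrassCurve ℤ).map (Int.castRingHom ℚ)).HasMultiplicativeReductionAt v →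
        ¬ p ∣ ((⟨0, 0, 0, -7, 10⟩ : WeierstrassCurve ℤ).map (Int.castRingHom ℚ)).ordMinimalDiscriminant v) ∧
      ∃ (K : Type) (_ : Field K) (_ : NumberField K), IsImaginaryQuadratic K ∧
        NumberField.discr K ≠ -3 ∧ NumberField.discr K ≠ -4 ∧
        ∃ (_ : NeZero (((⟨0, 0, 0, -7, 10⟩ : WeierstrassCurve ℤ).map (Int.castRingHom ℚ)).conductorNorm ℤ)),
          SatisfiesHeegnerHypothesis (((⟨0, 0, 0, -7, 10⟩ : WeierstrassCurve ℤ).map (Int.castRingHom ℚ)).conductorNorm ℤ) K ∧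
        ∃ (Dt : ModularParametrizationData ((⟨0, 0, 0, -7, 10⟩ : WeierstrassCurve ℤ).map (Int.castRingHom ℚ)) (((⟨0, 0, 0, -7, 10⟩ : WeierstrassCurve ℤ).map (Int.castRingHom ℚ)).conductorNorm ℤ))
          (β : ℤ) (ι : K →+* ℂ) (n₁ : ℕ) (d : KolyvaginHeegnerData Dt β ι n₁), Squarefree n₁ ∧
          (∀ q ∈ n₁.primeFactors, Zhang2014.IsKolyvaginPrime (((⟨0, 0, 0, -7, 10⟩ : WeierstrassCurve ℤ).map (Int.castRingHom ℚ)).conductorNorm ℤ)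
            ((⟨0, 0, 0, -7, 10⟩ : WeierstrassCurve ℤ).map (Int.castRingHom ℚ)) K p q) ∧
          d.kolyvaginClass hp.out 1 ≠ 0 ∧
          (n₁.primeFactors.card + 1 ≤ ((⟨0, 0, 0, -7, 10⟩ : WeierstrassCurve ℤ).map (Int.castRingHom ℚ)).mordellWeilRank ∨
            (n₁.primeFactors.card ≤ ((⟨0, 0, 0, -7, 10⟩ : WeierstrassCurve ℤ).map (Int.castRingHom ℚ)).mordellWeilRank ∧
              n₁.primeFactors.card + 1 ≤ (((⟨0, 0, 0, -7, 10⟩ : WeierstrassCurve ℤ).map (Int.castRingHom ℚ)).quadraticTwist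
                (NumberField.discr K : ℚ)).mordellWeilRank)) := by
  haveI := isElliptic_c664a1
  haveI := isGloballyMinimal_c664a1
  haveI iNZ : NeZero (((⟨0, 0, 0, -7, 10⟩ : WeierstrassCurve ℤ).map (Int.castRingHom ℚ)).conductorNorm ℤ) :=
    neZero_conductorNorm_of_isElliptic _
  haveI := minTwist39_isElliptic
  haveI := minTwist39_isGloballyMinimal
  haveI iNZT : NeZero (((⟨0, 0, 0, -10647, -593190⟩ : WeierstrassCurve ℤ).map (Int.castRingHom ℚ)).conductorNorm ℤ) :=
    neZero_conductorNorm_of_isElliptic _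
  haveI iP := Fact.mk (by norm_num : Nat.Prime 11)
  haveI : NeZero (469019 : ℕ) := ⟨by norm_num⟩
  have hH := satisfiesHeegnerHypothesis_conductorNorm_of_intModel intModel K hK.1 hD heegner_neg39
  have hodd : Odd (NumberField.discr K) := by rw [hD, Int.odd_iff]; norm_num
  have hD3 : NumberField.discr K ≠ -3 := by rw [hD]; norm_num
  have hD4 : NumberField.discr K ≠ -4 := by rw [hD]; norm_num
  have hpD : ¬ (((11 : ℕ) : ℤ) ∣ NumberField.discr K) := by rw [hD]; decide
  have hspl : SatisfiesHeegnerHypothesis 11 K :=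
    satisfiesHeegnerHypothesis_prime_of_jacobiSym664 K hK.1 hD 11 (by norm_num) (by norm_num) (by norm_num)
  have hsur : ((⟨0, 0, 0, -7, 10⟩ : WeierstrassCurve ℤ).map (Int.castRingHom ℚ)).HasSurjectiveModNGaloisRep ((11 : ℕ) : ℤ) := by
    simpa using hasSurjectiveModNGaloisRep_11
  have htower : ∀ k : ℕ, ((⟨0, 0, 0, -7, 10⟩ : WeierstrassCurve ℤ).map (Int.castRingHom ℚ)).HasSurjectiveModNGaloisRep ((11 : ℕ) ^ k : ℕ) :=
    serre_hasSurjectiveModNGaloisRep_pow_holds _ 11 (by norm_num) hsur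
  have hC : (⟨1, (0 : ℚ), (0 : ℚ), (0 : ℚ)⟩ : WeierstrassCurve.VariableChange ℚ) •
      ((⟨0, 0, 0, -10647, -593190⟩ : WeierstrassCurve ℤ).map (Int.castRingHom ℚ)) =
      ((⟨0, 0, 0, -7, 10⟩ : WeierstrassCurve ℤ).map (Int.castRingHom ℚ)).quadraticTwist (NumberField.discr K : ℚ) := by
    rw [hD]; push_cast; exact minTwist39_smul_eq
  have hrank : 2 ≤ ((⟨0, 0, 0, -7, 10⟩ : WeierstrassCurve ℤ).map (Int.castRingHom ℚ)).mordellWeilRank :=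
    KernelCerts001.C664a1.two_le_rank
  have hν' : (469019 : ℕ).primeFactors.card ≤ ((⟨0, 0, 0, -7, 10⟩ : WeierstrassCurve ℤ).map (Int.castRingHom ℚ)).mordellWeilRank := by
    refine le_trans (le_of_eq ?_) hrank
    rw [show (469019 : ℕ) = 463 * 1013 from rfl, Nat.primeFactors_mul (by norm_num) (by norm_num),
      Nat.Prime.primeFactors (by norm_num), Nat.Prime.primeFactors (by norm_num)]
    decide
  have hμ' : m.primeFactors.card ≤ ((⟨0, 0, 0, -7, 10⟩ : WeierstrassCurve ℤ).map (Int.castRingHom ℚ)).mordellWeilRank := hμ.trans hrank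
  exact cruxBody_of_kuriharaClaims_split hKim hnf hMaz h3 hZ hHZ _ hrank 11 (by norm_num) goodOrdinary_11.1 goodOrdinary_11.2 htower
    (kodairaNeron_of_five_le 11 (by norm_num)) nonAnomalous_11 K hK hodd hD3 hD4 hpD hspl hH 469019 isCyclicKolyvaginLevel_11_469019 hν' hδE
    ((⟨0, 0, 0, -10647, -593190⟩ : WeierstrassCurve ℤ).map (Int.castRingHom ℚ)) _ hC minTwist39_nonAnomalous_11
    minTwist39_kodairaNeron_11 m hm hμ' hδT

end C664a1

end Summit.BirchSwinnertonDyer.BirchSwinnertonDyer.Theorems.KolyvaginDepthDoor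

end
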